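import Literature.Computability.AlgebraicComplexity.SingleProductExchange
import HarnessLib

/-!
# The output-quotient substitution step behind the Y/Z 'point caps' of the ω-census (rule Q)

New work of the pub-omega census (ENG2 seat), topic `Summits/MatrixMultiplication/OmegaCensus`.
Framing: lottery ticket; floor = certified bounds/negative ranges. Kernel leg for the STRUCTURAL
half of rule (Q) of `pub-omega-eng2/results/xcaps/DERIVATION.md` §3 (the printed floors plugged
into it stay what they are); not a result about ω.

Setting. `φ : U × V → W` bilinear over a field, `W₀ ≤ W`, `V' ≤ V` with `φ(U × V') ⊆ W₀`, and the
values of `φ` span `W` modulo `W₀` (`W₀ + span φ(U × V) = W`). Then every bilinear computation of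
`φ` (Bläser 2003, Def. 1; tree `BilinComp`) of length `r` yields one of the corestriction
`φ' : U × V' → W₀` of length `r − (dim W − dim W₀)`: choose `dim W − dim W₀` products whose output
vectors span a complement `C` of `W₀`, project the outputs onto `W₀` along `C` (those products die,
values in `W₀` are unchanged) and restrict the second argument to `V'`
(`exists_outputQuotient`). Hence any lower bound `b` for `φ'` gives
`b + (dim W − dim W₀) ≤ r` (`add_le_card_of_outputQuotient`).

Census instance (on paper, DERIVATION.md §3): `φ = ⟨2,2,n⟩` restricted to `Y ∈ ker w` for a
`Y`-form `w` of rank `ρ`, `W₀` = outputs vanishing on the first `ρ` columns, `V'` = `Y` with the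
first `ρ` columns zero: `φ' ≅ ⟨2,2,n−ρ⟩`, so `R(⟨2,2,n⟩ | Y ∈ ker w) ≥ 2ρ + R(⟨2,2,n−ρ⟩)`.
-/

namespace Summit.MatrixMultiplication.OmegaCensus.SmallFormats

open Module Literature.Computability.AlgebraicComplexity

variable {k : Type*} [Field k]
variable {U V W : Type*} [AddCommGroup U] [Module k U] [AddCommGroup V] [Module k V]
  [AddCommGroup W] [Module k W]

/-- The corestriction `φ' : U × V' → W₀` of `φ` to a subspace `V'` of the second argument whose
values lie in `W₀`. -/
def corestrict₂ (φ : U →ₗ[k] V →ₗ[k] W) (V' : Submodule k V) (W₀ : Submodule k W)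
    (h : ∀ u, ∀ v ∈ V', φ u v ∈ W₀) : U →ₗ[k] V' →ₗ[k] W₀ :=
  LinearMap.mk₂ k (fun u v => ⟨φ u v, h u v v.2⟩)
    (fun u₁ u₂ v => by ext; simp)
    (fun c u v => by ext; simp)
    (fun u v₁ v₂ => by ext; simp)
    (fun c u v => by ext; simp)

/-- Values of the corestriction. -/
@[simp] theorem corestrict₂_apply (φ : U →ₗ[k] V →ₗ[k] W) (V' : Submodule k V) (W₀ : Submodule k W)
    (h : ∀ u, ∀ v ∈ V', φ u v ∈ W₀) (u : U) (v : V') :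
    ((corestrict₂ φ V' W₀ h u v : W₀) : W) = φ u v := rfl

namespace BilinCompQuot

variable {φ : U →ₗ[k] V →ₗ[k] W} {ι : Type*} [Fintype ι]

/-- Every value of `φ` lies in the span of the output vectors of a computation. -/
theorem apply_mem_span_range_w (β : BilinComp φ ι) (u : U) (v : V) :
    φ u v ∈ Submodule.span k (Set.range β.w) := by
  rw [β.map_eq_sum]
  exact Submodule.sum_mem _ fun i _ => Submodule.smul_mem _ _ (Submodule.subset_span ⟨i, rfl⟩)

end BilinCompQuot

open BilinCompQuot

/-- **Output-quotient step.** If `φ(U × V') ⊆ W₀` and the values of `φ` span `W` modulo `W₀`, a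
computation of `φ` indexed by `ι` yields a computation of the corestriction `φ' : U × V' → W₀`
indexed by the complement of a set `J` of `dim W − dim W₀` products. -/
theorem exists_outputQuotient [FiniteDimensional k W] {φ : U →ₗ[k] V →ₗ[k] W}
    {ι : Type*} [Fintype ι] [DecidableEq ι] (β : BilinComp φ ι)
    (V' : Submodule k V) (W₀ : Submodule k W) (hV' : ∀ u, ∀ v ∈ V', φ u v ∈ W₀)
    (hspan : W₀ ⊔ Submodule.span k (Set.range fun p : U × V => φ p.1 p.2) = ⊤) :
    ∃ J : Finset ι, J.card + finrank k W₀ = finrank k W ∧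
      Nonempty (BilinComp (corestrict₂ φ V' W₀ hV') {i // i ∉ J}) := by
  classical
  -- the output vectors span `W` modulo `W₀`
  have hSw : W₀ ⊔ Submodule.span k (Set.range β.w) = ⊤ := by
    apply top_unique
    rw [← hspan]
    refine sup_le_sup_left ?_ _
    rw [Submodule.span_le]
    rintro _ ⟨p, rfl⟩
    exact apply_mem_span_range_w β p.1 p.2
  -- in `W ⧸ W₀` the images `wq i` of the `w_i` span; extract an independent spanning subfamily `J`
  let wq : ι → W ⧸ W₀ := fun i => W₀.mkQ (β.w i)
  have hspan_all : Submodule.span k (Set.range wq) = ⊤ := by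
    have h1 : Submodule.map W₀.mkQ (W₀ ⊔ Submodule.span k (Set.range β.w)) = ⊤ := by
      rw [hSw, Submodule.map_top, Submodule.range_mkQ]
    rw [Submodule.map_sup, Submodule.mkQ_map_self, bot_sup_eq, Submodule.map_span] at h1
    rw [← h1]
    congr 1
    ext x
    simp only [Set.mem_range, Set.mem_image]
    constructor
    · rintro ⟨i, rfl⟩; exact ⟨β.w i, ⟨i, rfl⟩, rfl⟩
    · rintro ⟨_, ⟨i, rfl⟩, rfl⟩; exact ⟨i, rfl⟩
  obtain ⟨b, -, -, hbspan, hbli⟩ :=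
    exists_linearIndepOn_extension (linearIndepOn_empty k wq) (Set.empty_subset (Set.univ : Set ι))
  let J : Finset ι := (Set.toFinite b).toFinset
  have hJb : (J : Set ι) = b := by simp [J]
  have hJmem : ∀ i, i ∈ J ↔ i ∈ b := fun i => by simp [J]
  have hliJ : LinearIndepOn k wq (J : Set ι) := by rw [hJb]; exact hbli
  have hspanJ : Submodule.span k (wq '' (J : Set ι)) = ⊤ := by
    rw [hJb]
    apply top_unique
    rw [← hspan_all, Submodule.span_le]
    rintro _ ⟨i, rfl⟩
    exact hbspan ⟨i, Set.mem_univ i, rfl⟩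
  -- `|J| = dim (W ⧸ W₀) = dim W − dim W₀`
  have hJcard : J.card + finrank k W₀ = finrank k W := by
    have hli : LinearIndependent k (fun j : J => wq j) := hliJ
    have hsp : ⊤ ≤ Submodule.span k (Set.range fun j : J => wq j) := by
      rw [← hspanJ, Submodule.span_le]
      rintro _ ⟨i, hi, rfl⟩
      exact Submodule.subset_span ⟨⟨i, hi⟩, rfl⟩
    have hbasis := Basis.mk hli hsp
    have h1 : finrank k (W ⧸ W₀) = J.card := by
      rw [finrank_eq_card_basis hbasis, Fintype.card_coe]
    have h2 := Submodule.finrank_quotient_add_finrank W₀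
    omega
  -- the complement `C = span {w_j : j ∈ J}` of `W₀`
  let C : Submodule k W := Submodule.span k (β.w '' (J : Set ι))
  have hmapC : Submodule.map W₀.mkQ C = ⊤ := by
    rw [Submodule.map_span, ← hspanJ]
    congr 1
    ext x
    simp only [Set.mem_image]
    constructor
    · rintro ⟨_, ⟨i, hi, rfl⟩, rfl⟩; exact ⟨i, hi, rfl⟩
    · rintro ⟨i, hi, rfl⟩; exact ⟨β.w i, ⟨i, hi, rfl⟩, rfl⟩
  have hcodisj : Codisjoint W₀ C := by
    rw [codisjoint_iff, eq_top_iff]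
    intro x _
    have hx : x ∈ Submodule.comap W₀.mkQ (Submodule.map W₀.mkQ C) := by
      rw [hmapC]; exact Submodule.mem_top
    rw [Submodule.comap_map_eq, Submodule.ker_mkQ] at hx
    rwa [sup_comm] at hx
  have hdisj : Disjoint W₀ C := by
    -- `mkQ` maps `C` onto `W ⧸ W₀` and `dim C ≤ |J| = dim (W ⧸ W₀)`, so `mkQ` is injective on `C`
    have hCdim : finrank k C ≤ J.card := by
      have hC : C = Submodule.span k ((J.image β.w : Finset W) : Set W) := by
        simp [C, Finset.coe_image]
      rw [hC]
      exact (finrank_span_finset_le_card (J.image β.w)).trans Finset.card_image_le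
    let g : C →ₗ[k] W ⧸ W₀ := W₀.mkQ.domRestrict C
    have hrange : LinearMap.range g = ⊤ := by
      rw [LinearMap.range_domRestrict, hmapC]
    have hker : LinearMap.ker g = ⊥ := by
      have h1 := LinearMap.finrank_range_add_finrank_ker g
      rw [hrange, finrank_top] at h1
      have h2 : finrank k (W ⧸ W₀) = J.card := by
        have := Submodule.finrank_quotient_add_finrank W₀; omega
      have h3 : finrank k (LinearMap.ker g) = 0 := by omega
      exact Submodule.finrank_eq_zero.1 h3
    rw [Submodule.disjoint_def]
    intro x hx0 hxC
    have : (⟨x, hxC⟩ : C) ∈ LinearMap.ker g := by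
      rw [LinearMap.mem_ker]
      change W₀.mkQ x = 0
      rw [Submodule.mkQ_apply, Submodule.Quotient.mk_eq_zero]
      exact hx0
    rw [hker, Submodule.mem_bot] at this
    exact congrArg Subtype.val this
  have hcompl : IsCompl W₀ C := isCompl_iff.2 ⟨hdisj, hcodisj⟩
  -- project the outputs onto `W₀` along `C`
  let π : W →ₗ[k] W₀ := W₀.projectionOnto C hcompl
  have hπJ : ∀ j ∈ J, π (β.w j) = 0 := fun j hj =>
    Submodule.projectionOnto_apply_of_mem_right hcompl (Submodule.subset_span ⟨j, by simpa using hj, rfl⟩)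
  refine ⟨J, hJcard, ⟨{ f := fun i => β.f i.1, g := fun i => (β.g i.1).comp V'.subtype,
                          w := fun i => π (β.w i.1), map_eq_sum := fun u v => ?_ }⟩⟩
  -- `φ' u v = π (φ u v) = Σ_{i ∉ J} f_i u g_i v • π w_i`
  have h0 : corestrict₂ φ V' W₀ hV' u v = π (φ u v) := by
    rw [Submodule.projectionOnto_apply_of_mem_left hcompl (hV' u v v.2)]
    rfl
  rw [h0, β.map_eq_sum, map_sum]
  simp only [map_smul, LinearMap.comp_apply, Submodule.subtype_apply]
  set F : ι → W₀ := fun i => (β.f i u * β.g i (v : V)) • π (β.w i) with hF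
  have hzero : ∑ i ∈ J, F i = 0 :=
    Finset.sum_eq_zero fun i hi => by rw [hF]; dsimp only; rw [hπJ i hi, smul_zero]
  have hR : ∑ i ∈ Jᶜ, F i = ∑ i : {i // i ∉ J}, F i :=
    Finset.sum_subtype Jᶜ (fun i => Finset.mem_compl) F
  show ∑ i, F i = ∑ i : {i // i ∉ J}, F i
  rw [← hR, ← Finset.sum_compl_add_sum J F, hzero, add_zero]

/-- **Rule (Q), structural half.** Any lower bound `b` for the computations of the corestriction
`φ' : U × V' → W₀` gives `b + (dim W − dim W₀) ≤ |ι|` for every computation of `φ`, provided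
`φ(U × V') ⊆ W₀` and the values of `φ` span `W` modulo `W₀`. -/
theorem add_le_card_of_outputQuotient.{v} [FiniteDimensional k W] {φ : U →ₗ[k] V →ₗ[k] W}
    {ι : Type v} [Fintype ι] [DecidableEq ι] (β : BilinComp φ ι)
    (V' : Submodule k V) (W₀ : Submodule k W) (hV' : ∀ u, ∀ v ∈ V', φ u v ∈ W₀)
    (hspan : W₀ ⊔ Submodule.span k (Set.range fun p : U × V => φ p.1 p.2) = ⊤)
    (b : ℕ) (hb : ∀ (κ : Type v) [Fintype κ], BilinComp (corestrict₂ φ V' W₀ hV') κ → b ≤ Fintype.card κ) :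
    b + (finrank k W - finrank k W₀) ≤ Fintype.card ι := by
  classical
  obtain ⟨J, hJ, ⟨β'⟩⟩ := exists_outputQuotient β V' W₀ hV' hspan
  have h1 := hb _ β'
  rw [Fintype.card_subtype_compl, Fintype.card_coe] at h1
  have h2 : J.card ≤ Fintype.card ι := Finset.card_le_univ J
  omega

end Summit.MatrixMultiplication.OmegaCensus.SmallFormats
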